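import Literature.AlgebraicGeometry.ModuliOfAbelianVarieties.SiegelUniversalFamilyUniformisation   -- ★ P-3 tokens
import Literature.AlgebraicGeometry.ModuliOfAbelianVarieties.SiegelAdmissibleMarkingUnique          -- ★ `exists_siegelLevelGroup_smul_ratRep_of_lifts`
import Literature.AlgebraicGeometry.ModuliOfAbelianVarieties.SiegelShimuraSetPrincipalDissection    -- ★ `exists_principalRep`
import Literature.AlgebraicGeometry.ModuliOfAbelianVarieties.SiegelPeriodLiftLocallyUnique          -- ★ LIFT-UNIQ `exists_open_eqOn_of_exists_gDHom_smul`
import HarnessLib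

/-!
# The period matrix of an admissibly marked chart IS the lift: a P-3 chart in normal form along `Z` with `Z t₀ = s t₀` is a P-3 chart along `s` near `t₀`
# ([Milne2005ShimuraVarieties] §6 Thm. 6.11; [Lange2023AbelianVarietiesComplex] §3.1.3 Prop. 3.1.9 + Remark 3.1.10 (2), §3.4 Prop. 3.4.8; [BirkenhakeLange2004] §8.8)

Layer `Literature/AlgebraicGeometry/ModuliOfAbelianVarieties`, namespace `Literature.AlgebraicGeometry.ModuliOfAbelianVarieties`.  THEOREMS ONLY
(no definition, no named fact, no instance, no notation, no `sorry`).  Cell `hodgecm-mathlib` (D-0151), FLOOR 0, P6 «MOD» (crux hLiu418 =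
stmt-HodgeConjecture-24832, `--supports`), half A line L7, socket `stub_UNIVFAM` = ★ P-3 `siegelUniversalFamilyUniformisation` (E-LINE
`Cruxes/HLiu418/Lines/F0_P6a_PELWitnessE.lean` :654), organ **O5 «MATCH»** of `StubUNIVFAM.closer.skeleton.v1/v2` (LA7-plan deal v1 2026-09-02T02:05Z,
dealt to LA7-p02).  HC_CM is proved only modulo the printed citations until rung 0 closes; this file is count-neutral.

THE MATHEMATICS.  Organ O4 «ALIGN» delivers, near `t₀`, a relative exponential chart `(Φ₂, ex₂)` of `(P_T.A)^an → T^an` over an open `V′ ∋ t₀` in P-3's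
NORMAL FORM along SOME holomorphic `Z : V′ → 𝔥_g` with `Z t₀ = s t₀` (periods `Π_{Z t}`, (G), (ADM) at `(Z t, r)` for every principal `r`).
Organ O2 «ADMNF» delivers admissible packages of the fibres at `(s t, r)` along the given lift `s`.  Hence at every `t ∈ V′` the fibre
`A_t` is admissibly marked both at `(Z t, r₀)` and at `(s t, r₀)` (for one principal representative `r₀` of `c`, ★ `exists_principalRep`), so
`s t = M_t • Z t` with `M_t ∈ Γ_δ(N)` — [Milne2005ShimuraVarieties] Thm. 6.11, in the tree ★ `exists_siegelLevelGroup_smul_ratRep_of_lifts` —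
and since `Γ_δ(N)` (`N ≥ 3`) acts freely and properly discontinuously on `𝔥_g` ([Lange2023AbelianVarietiesComplex] Prop. 3.1.9, Remark 3.1.10 (2))
and `Z`, `s` are continuous with `Z t₀ = s t₀`, ★ LIFT-UNIQ `exists_open_eqOn_of_exists_gDHom_smul` gives an open `V″ ∋ t₀`, `V″ ⊆ V′`, with
`Z = s` on `V″`.  On `V″` the SAME chart `(Φ₂, ex₂)` is in normal form along `s`: the four P-3 conjuncts at `s` are those at `Z` rewritten
(`match_chart`).  In print: the universal family over `𝒜_D(D)` is `p̄ : 𝔛_D ∕ G_D(D) → 𝔥_g ∕ G_D(D)`, the sheets of `𝔥_g → 𝒜_D(D)` being permuted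
freely ([Lange2023AbelianVarietiesComplex] §3.4 Prop. 3.4.8; [BirkenhakeLange2004] §8.8).

* `match_chart` — THE O5 HEAD (binders: the skeleton's `MATCH` minus the unused piece clauses ∕ smoothness ∕ lift-equation binders; the five
  hypotheses and the conclusion token for token).

## References
* [Milne2005ShimuraVarieties] J. S. Milne, *Introduction to Shimura Varieties* (2005), §6 Thm. 6.11 p. 74.
* [Lange2023AbelianVarietiesComplex] H. Lange, *Abelian Varieties over the Complex Numbers* (2023), §3.1.3 Prop. 3.1.9, Remark 3.1.10 (2) (p0161–p0162);
  §3.4 Prop. 3.4.8 + Ex. 3.4.5 (7) pp. 190–191.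
* [BirkenhakeLange2004] C. Birkenhake, H. Lange, *Complex Abelian Varieties*, 2nd ed. (2004), §8.8 pp. 232–234.
-/

set_option autoImplicit false

noncomputable section

open CategoryTheory CategoryTheory.Limits AlgebraicGeometry Matrix Topology Set
open scoped Manifold ContDiff Matrix.Norms.Elementwise
open Literature.AlgebraicGeometry.Motives (SchemeOver ComplexPoints AlgPoints specOver AbelianVariety CartierDivisor)
open Literature.AlgebraicGeometry.AbelianSchemes (PolarizedAbelianSchemeWithLevel AbelianSchemeOver)
open Literature.Geometry.Kaehler (ComplexTorus)
open Literature.Geometry.Kaehler.ComplexTorus (cover)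
open Literature.Geometry.ComplexAnalytic (IsRelExpChartOn totalOver basePoint)
open Literature.NumberTheory.Transcendental (IsAnalytification)
open Literature.NumberTheory.Automorphic (siegelUpperHalfSpace)
open Literature.NumberTheory.Adeles (latticeOfGL)

namespace Literature.AlgebraicGeometry.ModuliOfAbelianVarieties

open SiegelModuli (jOfSiegel)

namespace SiegelUniversalFamilyChartMatch

/-- Entrywise holomorphic matrix-valued maps are continuous (plumbing). [folklore] -/
private theorem continuousOn_of_mdifferentiableOn_entries {g d : ℕ} {MT : Type} [TopologicalSpace MT] [ChartedSpace (Fin d → ℂ) MT]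
    {Z : MT → Matrix (Fin g) (Fin g) ℂ} {V : Set MT} (hZ : ∀ i j, MDifferentiableOn 𝓘(ℂ, Fin d → ℂ) 𝓘(ℂ, ℂ) (fun t => Z t i j) V) :
    ContinuousOn Z V :=
  continuousOn_pi.2 fun i => continuousOn_pi.2 fun j => (hZ i j).continuousOn

/-- **O5 «MATCH» — THE PERIOD MATRIX OF AN ADMISSIBLY MARKED CHART IS THE LIFT** ([Milne2005ShimuraVarieties] Thm. 6.11: two admissible period
points of one fibre are `Γ_δ(N)`-related — ★ `exists_siegelLevelGroup_smul_ratRep_of_lifts`; [Lange2023AbelianVarietiesComplex] Prop. 3.1.9 +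
Remark 3.1.10 (2): `Γ_δ(N)`, `N ≥ 3`, acts freely and properly discontinuously, so nearby related continuous lifts coincide — ★
`SiegelModuli.exists_open_eqOn_of_exists_gDHom_smul`): under the skeleton's `MATCH` binders, a chart `(Φ₂, ex₂)` over `V′ ∋ t₀`, `V′ ⊆ U`, in P-3's
normal form along a holomorphic `Z` with `Z t₀ = s t₀`, together with the ADMNF packages along `s`, restricts to an open `V″ ∋ t₀`, `V″ ⊆ U`, on
which it satisfies the FOUR P-3 conjuncts along `s` (`Z = s` on `V″`).
[cite: Milne2005ShimuraVarieties, §6 Thm. 6.11 p. 74] [cite: Lange2023AbelianVarietiesComplex, §3.1.3 Prop. 3.1.9 and Remark 3.1.10 (2); §3.4 Prop. 3.4.8 pp. 190–191]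
[cite: BirkenhakeLange2004, §8.8 pp. 232–234] -/
theorem match_chart :
  ∀ (g N : ℕ) (δ : Fin g → ℕ) (hg : 0 < g) (hδ : IsPolarizationType δ) (hN : 3 ≤ N) (𝓜 : SiegelFineModuliScheme g N δ)
    (c : (ZMod N)ˣ) (Sc : SchemeOver ℂ) (ιc : Sc ⟶ (Motives.baseChange ℚ ℂ).obj 𝓜.M)
    -- the base, the pulled-back universal triple and its analytifications (P-3's binders; the piece clauses are not needed here)
    (T : SchemeOver ℂ) (d : ℕ) (ψ : T ⟶ Sc)
    (MT : Type) [TopologicalSpace MT] [ChartedSpace (Fin d → ℂ) MT]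
    (φT : MT → ComplexPoints T) (hT : IsAnalytification (Fin d → ℂ) T d φT)
    (MA : Type) [TopologicalSpace MA] [ChartedSpace (Fin (d + g) → ℂ) MA]
    (φA : MA → ComplexPoints (totalOver T
      (𝓜.univ.baseChange (ψ.left ≫ ιc.left ≫ pullback.fst 𝓜.M.hom (Spec.map (CommRingCat.ofHom (algebraMap ℚ ℂ))))).A))
    (U : Set MT) (s : MT → Matrix (Fin g) (Fin g) ℂ) (hs : ∀ t ∈ U, s t ∈ siegelUpperHalfSpace g)
    (_ : ∀ i j, MDifferentiableOn 𝓘(ℂ, Fin d → ℂ) 𝓘(ℂ, ℂ) (fun t => s t i j) U)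
    -- organ binders: the point, `ALIGN`'s output, the normal-form packages along `U`
    (t₀ : MT) (V' : Set MT) (_ : IsOpen V') (_ : t₀ ∈ V') (_ : V' ⊆ U)
    (Z : MT → Matrix (Fin g) (Fin g) ℂ) (hZ : ∀ t ∈ V', Z t ∈ siegelUpperHalfSpace g)
    (_ : ∀ i j, MDifferentiableOn 𝓘(ℂ, Fin d → ℂ) 𝓘(ℂ, ℂ) (fun t => Z t i j) V') (_ : Z t₀ = s t₀)
    (Φ₂ : MT → ((Fin g ⊕ Fin g → ℝ) ≃L[ℝ] (Fin g → ℂ))) (ex₂ : MT × (Fin g → ℂ) → MA),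
  letI P := 𝓜.univ.baseChange (ψ.left ≫ ιc.left ≫ pullback.fst 𝓜.M.hom (Spec.map (CommRingCat.ofHom (algebraMap ℚ ℂ))))
  (∀ t ∈ V', ∀ v : Fin g ⊕ Fin g → ℝ, Φ₂ t v = siegelPeriodMap δ (Z t) v) →
  IsRelExpChartOn (Fin d → ℂ) (Fin (d + g) → ℂ) (basePoint hT P.A φA) V' Φ₂ ex₂ →
  (∀ t ∈ V', ∃ φt : ComplexTorus (Φ₂ t) → (P.A.fibre (φT t).left).toAbelianVariety.Points ℂ,
    IsAnalytification (Fin g → ℂ) (P.A.fibre (φT t).left).toAbelianVariety.X g φt ∧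
    (∀ x y, φt (x + y) = φt x * φt y) ∧
    ∀ z : Fin g → ℂ, (φA (ex₂ (t, z))).left = P.A.fibrePointToLeft (φT t).left (φt (cover (Φ₂ t) z))) →
  (∀ (u : finAdeleQˣ) (r : gspFinAdelic δ),
    (∀ v, Valued.v ((u : finAdeleQ) v) = 1) →
    (u : finAdeleQ) - ((c : ZMod N).val : ℕ) ∈ levelIdeal N →
    r ∈ principalLevelSubgroup δ 1 →
    IsMultiplier (typeFormOver δ finAdeleQ) (r : GL (Fin g ⊕ Fin g) finAdeleQ) u →
    ((r : GL (Fin g ⊕ Fin g) finAdeleQ) : Matrix (Fin g ⊕ Fin g) (Fin g ⊕ Fin g) finAdeleQ) =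
      Matrix.fromBlocks 1 0 0 ((u : finAdeleQ) • (1 : Matrix (Fin g) (Fin g) finAdeleQ)) →
    ∀ (t : MT) (ht : t ∈ V'),
      ∃ (m : SiegelAdelicMarking ⟨jOfSiegel δ (Z t), SiegelComplexRecordSystem.jOfSiegel_mem_C0pm hδ.1 (hZ t ht)⟩ r
            (P.A.fibre (φT t).left).toAbelianVariety)
        (Θ : CartierDivisor (P.A.fibre (φT t).left).toAbelianVariety.X.left)
        (Λ : P.level.SymplecticLift (φT t).left Θ δ),
        Θ.IsAmple ∧ P.A.IsLambdaOfAt (φT t).left P.D P.pol.lam Θ ∧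
        (∀ ⦃M : ℕ⦄, N ∣ M → M ≠ 0 → ∀ (x : Fin g ⊕ Fin g → ZMod M) (v : Fin g ⊕ Fin g → ℚ),
          AdelicCongr ((r⁻¹ : gspFinAdelic δ) : GL (Fin g ⊕ Fin g) finAdeleQ) 1 v (fun i => ((x i).val : ℚ) / M) →
            ((Λ.lift M (Multiplicative.ofAdd x)) : (P.A.fibre (φT t).left).toAbelianVariety.Points ℂ) = m.r v) ∧
        m.γ = 1 ∧ (∀ v : Fin g ⊕ Fin g → ℝ, m.Ψ v = siegelPeriodMap δ (Z t) v) ∧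
        ∀ z : Fin g → ℂ, P.A.fibrePointToLeft (φT t).left (m.toFun (cover m.Ψ z)) = (φA (ex₂ (t, z))).left) →
  (∀ (u : finAdeleQˣ) (r : gspFinAdelic δ),
    (∀ v, Valued.v ((u : finAdeleQ) v) = 1) →
    (u : finAdeleQ) - ((c : ZMod N).val : ℕ) ∈ levelIdeal N →
    r ∈ principalLevelSubgroup δ 1 →
    IsMultiplier (typeFormOver δ finAdeleQ) (r : GL (Fin g ⊕ Fin g) finAdeleQ) u →
    ((r : GL (Fin g ⊕ Fin g) finAdeleQ) : Matrix (Fin g ⊕ Fin g) (Fin g ⊕ Fin g) finAdeleQ) =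
      Matrix.fromBlocks 1 0 0 ((u : finAdeleQ) • (1 : Matrix (Fin g) (Fin g) finAdeleQ)) →
    ∀ (t : MT) (ht : t ∈ U),
      ∃ (m : SiegelAdelicMarking ⟨jOfSiegel δ (s t), SiegelComplexRecordSystem.jOfSiegel_mem_C0pm hδ.1 (hs t ht)⟩ r
            (P.A.fibre (φT t).left).toAbelianVariety)
        (Θ : CartierDivisor (P.A.fibre (φT t).left).toAbelianVariety.X.left)
        (Λ : P.level.SymplecticLift (φT t).left Θ δ),
        Θ.IsAmple ∧ P.A.IsLambdaOfAt (φT t).left P.D P.pol.lam Θ ∧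
        (∀ ⦃M : ℕ⦄, N ∣ M → M ≠ 0 → ∀ (x : Fin g ⊕ Fin g → ZMod M) (v : Fin g ⊕ Fin g → ℚ),
          AdelicCongr ((r⁻¹ : gspFinAdelic δ) : GL (Fin g ⊕ Fin g) finAdeleQ) 1 v (fun i => ((x i).val : ℚ) / M) →
            ((Λ.lift M (Multiplicative.ofAdd x)) : (P.A.fibre (φT t).left).toAbelianVariety.Points ℂ) = m.r v) ∧
        m.γ = 1 ∧ (∀ v : Fin g ⊕ Fin g → ℝ, m.Ψ v = siegelPeriodMap δ (s t) v)) →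
  ∃ (V'' : Set MT) (_ : IsOpen V'') (_ : t₀ ∈ V'') (hV''U : V'' ⊆ U)
    (Φ : MT → ((Fin g ⊕ Fin g → ℝ) ≃L[ℝ] (Fin g → ℂ))) (ex : MT × (Fin g → ℂ) → MA),
    (∀ t ∈ V'', ∀ v : Fin g ⊕ Fin g → ℝ, Φ t v = siegelPeriodMap δ (s t) v) ∧
    IsRelExpChartOn (Fin d → ℂ) (Fin (d + g) → ℂ) (basePoint hT P.A φA) V'' Φ ex ∧
    (∀ t ∈ V'', ∃ φt : ComplexTorus (Φ t) → (P.A.fibre (φT t).left).toAbelianVariety.Points ℂ,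
      IsAnalytification (Fin g → ℂ) (P.A.fibre (φT t).left).toAbelianVariety.X g φt ∧
      (∀ x y, φt (x + y) = φt x * φt y) ∧
      ∀ z : Fin g → ℂ, (φA (ex (t, z))).left = P.A.fibrePointToLeft (φT t).left (φt (cover (Φ t) z))) ∧
    (∀ (u : finAdeleQˣ) (r : gspFinAdelic δ),
      (∀ v, Valued.v ((u : finAdeleQ) v) = 1) →
      (u : finAdeleQ) - ((c : ZMod N).val : ℕ) ∈ levelIdeal N →
      r ∈ principalLevelSubgroup δ 1 →
      IsMultiplier (typeFormOver δ finAdeleQ) (r : GL (Fin g ⊕ Fin g) finAdeleQ) u →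
      ((r : GL (Fin g ⊕ Fin g) finAdeleQ) : Matrix (Fin g ⊕ Fin g) (Fin g ⊕ Fin g) finAdeleQ) =
        Matrix.fromBlocks 1 0 0 ((u : finAdeleQ) • (1 : Matrix (Fin g) (Fin g) finAdeleQ)) →
      ∀ (t : MT) (ht : t ∈ V''),
        ∃ (m : SiegelAdelicMarking ⟨jOfSiegel δ (s t), SiegelComplexRecordSystem.jOfSiegel_mem_C0pm hδ.1 (hs t (hV''U ht))⟩ r
              (P.A.fibre (φT t).left).toAbelianVariety)
          (Θ : CartierDivisor (P.A.fibre (φT t).left).toAbelianVariety.X.left)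
          (Λ : P.level.SymplecticLift (φT t).left Θ δ),
          Θ.IsAmple ∧ P.A.IsLambdaOfAt (φT t).left P.D P.pol.lam Θ ∧
          (∀ ⦃M : ℕ⦄, N ∣ M → M ≠ 0 → ∀ (x : Fin g ⊕ Fin g → ZMod M) (v : Fin g ⊕ Fin g → ℚ),
            AdelicCongr ((r⁻¹ : gspFinAdelic δ) : GL (Fin g ⊕ Fin g) finAdeleQ) 1 v (fun i => ((x i).val : ℚ) / M) →
              ((Λ.lift M (Multiplicative.ofAdd x)) : (P.A.fibre (φT t).left).toAbelianVariety.Points ℂ) = m.r v) ∧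
          m.γ = 1 ∧ (∀ v : Fin g ⊕ Fin g → ℝ, m.Ψ v = siegelPeriodMap δ (s t) v) ∧
          ∀ z : Fin g → ℂ, P.A.fibrePointToLeft (φT t).left (m.toFun (cover m.Ψ z)) = (φA (ex (t, z))).left) := by
  intro g N δ hg hδ hN 𝓜 c Sc ιc T d ψ MT _ _ φT hT MA _ _ φA U s hs hsd t₀ V' hV'o ht₀ hV'U Z hZ hZd hZ₀ Φ₂ ex₂ hΦ₂ hex₂ hG hADMZ hADMs
  -- one principal representative `r₀` of `c`
  have hN0 : N ≠ 0 := by omega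
  obtain ⟨u₀, r₀, hu₀, hu₀c, hr₀, hmult₀, hmat₀⟩ := exists_principalRep δ hN0 c
  -- at every `t ∈ V′` the fibre is admissibly marked at `(Z t, r₀)` and at `(s t, r₀)`: the two period points are `Γ_δ(N)`-related
  have hrel : ∀ t (ht : t ∈ V'), ∃ M : symplecticLatticeGroup δ, (M : GL (Fin g ⊕ Fin g) ℤ) ∈ siegelLevelGroup δ N ∧
      (⟨s t, hs t (hV'U ht)⟩ : siegelUpperHalfSpace g) = SiegelModuli.gDHom δ hδ.1 M • (⟨Z t, hZ t ht⟩ : siegelUpperHalfSpace g) := by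
    intro t ht
    obtain ⟨m, Θ, Λ, -, hΘl, hΛ, -, -, -⟩ := hADMZ u₀ r₀ hu₀ hu₀c hr₀ hmult₀ hmat₀ t ht
    obtain ⟨m', Θ', Λ', -, hΘl', hΛ', -, -⟩ := hADMs u₀ r₀ hu₀ hu₀c hr₀ hmult₀ hmat₀ t (hV'U ht)
    obtain ⟨M, hM, hMZ, -⟩ := exists_siegelLevelGroup_smul_ratRep_of_lifts hg hδ hN hr₀ (hZ t ht) (hs t (hV'U ht))
      m Λ hΘl hΛ m' Λ' hΘl' hΛ'
    exact ⟨M, hM, hMZ⟩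
  -- unique continuation of lifts: `Z = s` on an open `V″ ∋ t₀`, `V″ ⊆ V′`
  obtain ⟨V'', hV''o, ht₀'', hV''V', heq⟩ :=
    SiegelModuli.exists_open_eqOn_of_exists_gDHom_smul hδ.1 hN hV'o ht₀ (continuousOn_of_mdifferentiableOn_entries hZd)
      ((continuousOn_of_mdifferentiableOn_entries hsd).mono hV'U) hZ (fun t ht => hs t (hV'U ht)) hZ₀ hrel
  have hV''U : V'' ⊆ U := hV''V'.trans hV'U
  refine ⟨V'', hV''o, ht₀'', hV''U, Φ₂, ex₂, fun t ht v => ?_, hex₂.mono hV''o hV''V', fun t ht => hG t (hV''V' ht), ?_⟩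
  · rw [hΦ₂ t (hV''V' ht) v, heq t ht]
  · intro u r hu huc hr hmult hmat t ht
    -- transport the (ADM) package from `Z t` to `s t = Z t`
    have key : ∀ (W : Matrix (Fin g) (Fin g) ℂ) (hW : W ∈ siegelUpperHalfSpace g), Z t = W →
        letI P := 𝓜.univ.baseChange (ψ.left ≫ ιc.left ≫ pullback.fst 𝓜.M.hom (Spec.map (CommRingCat.ofHom (algebraMap ℚ ℂ))))
        ∃ (m : SiegelAdelicMarking ⟨jOfSiegel δ W, SiegelComplexRecordSystem.jOfSiegel_mem_C0pm hδ.1 hW⟩ r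
              (P.A.fibre (φT t).left).toAbelianVariety)
          (Θ : CartierDivisor (P.A.fibre (φT t).left).toAbelianVariety.X.left)
          (Λ : P.level.SymplecticLift (φT t).left Θ δ),
          Θ.IsAmple ∧ P.A.IsLambdaOfAt (φT t).left P.D P.pol.lam Θ ∧
          (∀ ⦃M : ℕ⦄, N ∣ M → M ≠ 0 → ∀ (x : Fin g ⊕ Fin g → ZMod M) (v : Fin g ⊕ Fin g → ℚ),
            AdelicCongr ((r⁻¹ : gspFinAdelic δ) : GL (Fin g ⊕ Fin g) finAdeleQ) 1 v (fun i => ((x i).val : ℚ) / M) →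
              ((Λ.lift M (Multiplicative.ofAdd x)) : (P.A.fibre (φT t).left).toAbelianVariety.Points ℂ) = m.r v) ∧
          m.γ = 1 ∧ (∀ v : Fin g ⊕ Fin g → ℝ, m.Ψ v = siegelPeriodMap δ W v) ∧
          ∀ z : Fin g → ℂ, P.A.fibrePointToLeft (φT t).left (m.toFun (cover m.Ψ z)) = (φA (ex₂ (t, z))).left := by
      rintro W hW rfl
      exact hADMZ u r hu huc hr hmult hmat t (hV''V' ht)
    exact key (s t) (hs t (hV''U ht)) (heq t ht)

end SiegelUniversalFamilyChartMatch

end Literature.AlgebraicGeometry.ModuliOfAbelianVarieties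

end
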